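import Summits.HodgeConjecture.HodgeConjecture.Theorems.GenericDivisibilityGenericDivisibilityBoundedSupportedTop
import HarnessLib

/-!
# Route GenericDivisibility — crux C2 `GenericDivisibilityBounded` (stmt-HodgeConjecture-18467):
# the classes that are Hodge modulo coniveau one are stable under the bootstrap step of the line

Line `finite-level-bootstrap`, registered sub-goal `stub_hodgeModConiveau_of_sub_genericallyTorsion`
(lead c5, wave 2). Sorry-free, definition-free. `X` is smooth projective over `ℂ` of dimension `2p`,
`p ≥ 1`, `H = H²ᵖ(X(ℂ); ℤ)`, `z ⊗ ℂ = ringChange (ℤ → ℂ) z`, `z| = z|_{(X∖Z)(ℂ)}`,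
`N¹ = supportedClasses X (2p) 1` (complex classes dying on the complex points of a non-empty Zariski
open), and (spelled inline, as in the funnel file `…LevelCleanFunnel`) "`x` is GENERICALLY TORSION"
(`x ∈ GT`) means `∃ Z` closed `≠ univ`, `∃ N ≥ 1`, `N • x| = 0`.

Write `A(X)` for the integral classes `z ∈ H` that are **Hodge modulo coniveau one**:
`z ⊗ ℂ - h ∈ N¹` for some RATIONAL class `h` of Hodge type `(p, p)`. The line bootstraps its heart
along the `ℓ`-adic tower, passing from `z` to `w` whenever `z - ℓ^(j+1) • w ∈ GT`; this file shows
that `A(X)` is stable under that step, for any multiplier `c ≥ 1`: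
`z ∈ A(X)`, `z - c • w ∈ GT` ⟹ `w ∈ A(X)`.

Proof. `GT ⊗ ℂ ⊆ N¹` (the landed bridge
`genericDivisibilityBounded_genericallyTorsion_iff_ringChange_mem_supportedClasses`, Bloch–Ogus), so
`n₁ := (z - c • w) ⊗ ℂ ∈ N¹`; with `n₀ := z ⊗ ℂ - h ∈ N¹` one has `c • (w ⊗ ℂ) - h = n₀ - n₁`, hence
`w ⊗ ℂ - c⁻¹ • h = c⁻¹ • (n₀ - n₁) ∈ N¹` (`N¹` is a `ℂ`-subspace), and `c⁻¹ • h` is again rational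
(`c⁻¹ ∈ ℚ`) and of Hodge type `(p, p)` (`H^{p,p}` is a `ℂ`-subspace).

## Main results

* `genericDivisibilityBounded_hodgeModConiveauOne_of_ringChange_sub_nsmul_mem_supportedClasses` —
  the linear-algebra core: `z ∈ A(X)`, `(z - c • w) ⊗ ℂ ∈ N¹`, `c ≥ 1` ⟹ `w ∈ A(X)` (any `X`);
* `stub_hodgeModConiveau_of_sub_genericallyTorsion` — the registered signature, verbatim.

References: [VoisinHodgeI2002] §7.1.1, §11.3 Conj. 11.24; [BlochOgus1974ENS] (3.8);
[HatcherAT2002] §3.1 Thm. 3.2; [GrothendieckTopology1969] §1.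
-/

-- `Summit.HodgeConjecture.HodgeConjecture.Theorems` is the mandated namespace (single-problem
-- summit: Problem = Summit), which `linter.dupNamespace` flags on every declaration; the lakefile
-- turns the linter off tree-wide (weak option), restated here so stand-alone elaboration is
-- warning-free too.
set_option linter.dupNamespace false

noncomputable section

namespace Summit.HodgeConjecture.HodgeConjecture.Theorems

open CategoryTheory AlgebraicGeometry
open Literature.AlgebraicGeometry.Motives Literature.AlgebraicGeometry.HodgeTheory
  Literature.AlgebraicTopology.SingularHomology

/-! ### The linear-algebra core: divide the Hodge representative by `c` -/

/-- **`A(X)` is stable under `(z, w) ↦ w` when `(z - c • w) ⊗ ℂ ∈ N¹`, `c ≥ 1`.** If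
`z ⊗ ℂ - h ∈ N¹ = supportedClasses X (2p) 1` with `h` rational of Hodge type `(p, p)`, and
`(z - c • w) ⊗ ℂ ∈ N¹` for some `c ≥ 1`, then `w ⊗ ℂ - c⁻¹ • h ∈ N¹`, where `c⁻¹ • h` is rational
(`c⁻¹ ∈ ℚ`, Voisin I §7.1.1) and of Hodge type `(p, p)` (`H^{p,p}` is a `ℂ`-subspace): indeed
`w ⊗ ℂ - c⁻¹ • h = c⁻¹ • ((z ⊗ ℂ - h) - (z - c • w) ⊗ ℂ)` and `N¹` is a `ℂ`-subspace
(Grothendieck's coniveau filtration). No hypothesis on `X` is needed.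
[cite: VoisinHodgeI2002, §7.1.1] [cite: GrothendieckTopology1969, §1] -/
theorem genericDivisibilityBounded_hodgeModConiveauOne_of_ringChange_sub_nsmul_mem_supportedClasses
    {p : ℕ} {X : SchemeOver ℂ} {z w : singularCohomology ℤ ℤ (ComplexPoints X) (2 * p)} {c : ℕ}
    (hc : 1 ≤ c)
    (hz : ∃ h : complexBetti X (2 * p), IsRationalClass h ∧ IsOfHodgeType (2 * p) X (2 * p) p p h ∧
      singularCohomology.ringChange (Int.castRingHom ℂ) (ComplexPoints X) (2 * p) z - h ∈
        supportedClasses X (2 * p) 1)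
    (hzw : singularCohomology.ringChange (Int.castRingHom ℂ) (ComplexPoints X) (2 * p) (z - c • w) ∈
      supportedClasses X (2 * p) 1) :
    ∃ h : complexBetti X (2 * p), IsRationalClass h ∧ IsOfHodgeType (2 * p) X (2 * p) p p h ∧
      singularCohomology.ringChange (Int.castRingHom ℂ) (ComplexPoints X) (2 * p) w - h ∈
        supportedClasses X (2 * p) 1 := by
  obtain ⟨h, hrat, hpp, hn₀⟩ := hz
  have hc' : (c : ℂ) ≠ 0 := Nat.cast_ne_zero.2 (by omega)
  refine ⟨(c : ℂ)⁻¹ • h, ?_, ?_, ?_⟩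
  · -- `c⁻¹ • h` is rational: `c⁻¹ ∈ ℚ`
    have hq : IsRationalClass ((((c : ℚ)⁻¹ : ℚ) : ℂ) • h) := hrat.smul _
    rwa [Rat.cast_inv, Rat.cast_natCast] at hq
  · -- `c⁻¹ • h` is of Hodge type `(p, p)`: `H^{p,p}` is a `ℂ`-subspace
    obtain ⟨A, hA⟩ := hpp
    exact ⟨A, by rw [map_smul]; exact Submodule.smul_mem _ _ hA⟩
  · -- `w ⊗ ℂ - c⁻¹ • h = c⁻¹ • (n₀ - n₁) ∈ N¹`, `n₀ = z ⊗ ℂ - h`, `n₁ = (z - c • w) ⊗ ℂ`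
    set ι := singularCohomology.ringChange (Int.castRingHom ℂ) (ComplexPoints X) (2 * p)
    rw [map_sub, map_nsmul, ← Nat.cast_smul_eq_nsmul ℂ c] at hzw
    have key : (c : ℂ)⁻¹ • ((ι z - h) - (ι z - (c : ℂ) • ι w)) = ι w - (c : ℂ)⁻¹ • h := by
      rw [sub_sub_sub_cancel_left, smul_sub, smul_smul, inv_mul_cancel₀ hc', one_smul]
    rw [← key]
    exact Submodule.smul_mem _ _ (Submodule.sub_mem _ hn₀ hzw)

/-! ### The registered sub-goal -/

/-- **Registered sub-goal `stub_hodgeModConiveau_of_sub_genericallyTorsion` of line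
`finite-level-bootstrap` (crux C2, stmt-HodgeConjecture-18467), verbatim.** On a smooth projective
complex `2p`-fold `X`, `p ≥ 1`: if `z ∈ H²ᵖ(X(ℂ);ℤ)` is Hodge modulo coniveau one (`z ⊗ ℂ - h ∈ N¹`
with `h` rational of Hodge type `(p, p)`) and `z - c • w` is generically torsion for some `c ≥ 1`
(`∃ Z` closed `≠ univ`, `∃ N ≥ 1`, `N • (z - c • w)|_{(X∖Z)(ℂ)} = 0`), then `w` is Hodge modulo
coniveau one too. For `GT ⊗ ℂ ⊆ N¹` (Bloch–Ogus (3.8) with universal coefficients, the landed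
`genericDivisibilityBounded_genericallyTorsion_iff_ringChange_mem_supportedClasses`), and then one
divides `h` by `c`
(`genericDivisibilityBounded_hodgeModConiveauOne_of_ringChange_sub_nsmul_mem_supportedClasses`).
[cite: VoisinHodgeI2002, §11.3 Conj. 11.24] [cite: BlochOgus1974ENS, (3.8)]
[cite: HatcherAT2002, §3.1 Thm. 3.2] -/
theorem stub_hodgeModConiveau_of_sub_genericallyTorsion :
    ∀ ⦃p : ℕ⦄ ⦃X : SchemeOver ℂ⦄, 1 ≤ p → IsSmoothProjective (2 * p) X →
      ∀ (z w : singularCohomology ℤ ℤ (ComplexPoints X) (2 * p)) (c : ℕ), 1 ≤ c →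
        (∃ h : complexBetti X (2 * p), IsRationalClass h ∧ IsOfHodgeType (2 * p) X (2 * p) p p h ∧
          singularCohomology.ringChange (Int.castRingHom ℂ) (ComplexPoints X) (2 * p) z - h ∈
            supportedClasses X (2 * p) 1) →
        (∃ Z : Set X.left, IsClosed Z ∧ Z ≠ Set.univ ∧ ∃ N : ℕ, 1 ≤ N ∧
          N • singularCohomology.map ℤ ℤ
            (⟨Subtype.val, continuous_subtype_val⟩ : C(complexPointsCompl X Z, ComplexPoints X))
            (2 * p) (z - c • w) = 0) →
        ∃ h : complexBetti X (2 * p), IsRationalClass h ∧ IsOfHodgeType (2 * p) X (2 * p) p p h ∧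
          singularCohomology.ringChange (Int.castRingHom ℂ) (ComplexPoints X) (2 * p) w - h ∈
            supportedClasses X (2 * p) 1 := by
  intro p X hp hX z w c hc hz hGT
  exact genericDivisibilityBounded_hodgeModConiveauOne_of_ringChange_sub_nsmul_mem_supportedClasses
    hc hz
    ((genericDivisibilityBounded_genericallyTorsion_iff_ringChange_mem_supportedClasses hX
      (show 1 ≤ 2 * p by omega) _).1 hGT)

end Summit.HodgeConjecture.HodgeConjecture.Theorems

end
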